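import Literature.MathematicalPhysics.QuantumFieldTheory.Balaban1983to89.B11Eq117TransformationNormComp
import Literature.MathematicalPhysics.QuantumFieldTheory.Balaban1983to89.B9Eq310HessianOperator

/-!
# `Balaban1983to89.B11Eq117ReadLettersBridge` — T. Bałaban, *The variational problem and background fields in renormalization group method for lattice
# gauge theories*, Commun. Math. Phys. **102** (1985) 277–309 [Balaban1985Variational] (117) p. 295 *«By Theorem 3.13 of [5] the norm max{|·|_{(−1)}, |∇·|_{(−2)}}
# of the transformation can be estimated by B₀|J|_{(−3)} + …»*, (103) p. 293 (*«|H₁B|, |∇H₁B| … ≤ …|B|»*, the `H₁`-slot of the chart (174) p. 305), with [5] =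
# [Balaban1985BackgroundPropagators] Thm 3.13 p. 426, Thm 3.12 p. 423, Thm 3.1 (3.42)∕(3.47) pp. 397–398 and (3.3) p. 391, (3.11) p. 392: **THE CARRIER BRIDGE — sup → sup
# LETTERS OF AN OPERATOR ON THE `W`-VALUED LATTICE FUNCTIONS (value AND covariant gradient `∇_U = covGrad η⁻¹ Ad_W(U)`, ONE height-free constant each) BECOME THE
# OPERATOR NORMS OF THE CHART's LETTERS `𝔊 = frakGLatticeCLM φ …`, `H₁ = H1LatticeCLM φ …` READ ALONG THE FIBRE IDENTIFICATION `φ : W ≃ 𝔸` IN THE SPACE (115) OVER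
# `𝔸` WITH THE DERIVATIVE `nabla115 η U`, AT THE PRICE `M_φ·M_φ′`** — the bridge named and left open by the NE9 owner's `B11Eq117TransformationNormComp` («the instance
# `T := G₁,k` ∕ `𝔊̃_k` read on `𝔸`-valued functions (the carrier bridge `WL2` ↔ `NegSup`, prices `M_φ, M_φ′`) is NOT here») and by `t4/…/g97/PLAN-V16-SEED.md` §2 (d)
# («carrier bridge WL2 ↔ B11Eq115Space/NegSup (`readFun`∕`funEquiv`)»); the consumer is the k-level `cur U` chart (`Support/NE9CurChartTowerPiUniformBall`), whose
# only lattice-dependent inputs are these two operator norms (WALL-NE9-P1 v1.14.20 «residual non-uniformity = (117)'s displayed product ONLY»)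

statement-level skeleton of published theorems with citation tags; proofs where landed; nothing here is a claim about the Yang–Mills mass gap

CITATION HEADER (lean-in-tree rule).  Audit cell `pub-balaban`, sub-cell `t4`, BINDER row NE9; NE9 crux-team LEAF PROVER 01 (`b2b-balaban-t4-ne9-formalise-leaf-01`, gen 96;
(I-3); bears_on: R4/N22).  STOREY I of the (117)∕(103) programme.  [folklore] bookkeeping on finite lattices: no inequality of the series is proved; the ingredients are
`B11Eq117TransformationNormComp.norm_toCLM115_le_of_comp` (the owner's pair socket), `B11Eq103H1Complex.readFun ∕ funEquiv ∕ H1CLM ∕ frakGLatticeCLM`,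
`B11Eq117TransformationNorm.frakGLin_fun_eq_readFun`, `B11Eq111FrakG.nabla115_apply`, `B9Eq310HessianOperator.adTransportW_apply`.  Sources read through the audited
headers of those files (`paper:balaban1985-cmp102-variational-background` p. 293 (103), p. 295 (117), p. 305 (174); `paper:balaban1985-cmp99-background-propagators`
p. 391 (3.3), p. 392 (3.11), pp. 397–398 (3.42)∕(3.47), p. 423 Thm 3.12, p. 426 Thm 3.13).  Nothing printed is a hypothesis or a conclusion here.

WHAT IS PROVED (sorry-free; proof lane — 0 `def`; [folklore]).
* §1 **`norm_blockCLM115_apply_le_of_comp`**, **`norm_blockCLM115_le_of_comp`** — the BLOCK-FIELD analogue of the owner's pair socket: `‖blockCLM115 ∇ T‖ ≤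
  max(w̄₀·M_T, w̄₁·M_{∇T})·w̲_B⁻¹` from `‖Tg‖_∞ ≤ M_T‖g‖_∞` and the COMPOSITE `‖∇(Tg)‖_∞ ≤ M_{∇T}‖g‖_∞` ((103)'s two rows for `H₁`).
* §2 reading identities and pointwise prices: **`equiv_funEquiv_symm_norm_le`** (`‖(φ⁻¹∘g)(y)‖ ≤ M_φ′‖g‖_∞`), **`nabla115_readFun_apply`** (`∇^{𝔸}_U(φ∘F) = φ∘∇^{W}_U F`
  for `F = T(φ⁻¹∘g)`: `nabla115 η U (readFun φ T g) p = φ (covGrad η⁻¹ (adTransportW φ U) (Tφ⁻¹g) p)`), **`norm_readFun_le_of_global`**, **`norm_nabla115_readFun_le_of_global`**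
  (a `W`-level global letter with constant `B` ⟹ the `𝔸`-level letter with constant `M_φ·B·M_φ′`).
* §3 operator norms: **`norm_toCLM115_readFun_le_of_global`** (bond → bond maps), **`norm_H1CLM_le_of_global`** (block → bond maps).
* §4 at the lattice letters: **`frakGLatticeCLM_eq_toCLM115_readFun`** (`𝔊` of the chart IS `toCLM115 ∇ (readFun φ 𝔊_{L²})`), **`norm_frakGLatticeCLM_le_of_global`**,
  **`norm_H1LatticeCLM_le_of_global`** — the (117) and (103) sockets IN THE CHART's CURRENCY from `W`-level sup → sup letters of `frakGLatticeK hpos hQ` ∕ `H1LatticeK hpos hQ`.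
HONEST SCOPE.  Generic finite-lattice bookkeeping (any data `Δ₁, R, S, Rr, Q, a`, any background `U` and scalar `η` of the (115)-derivative, any level ∕ weight profile);
the letters are HYPOTHESES; nothing of [B11] (103)∕(117) or [B9] Thms 3.12∕3.13 is asserted, valued or discharged.  NOT NE9 (cell pub-balaban: NE9 NOT PRINTED ∕ NOT PROVED;
«NE9 ⇐ the named binders»; row WALLED ON A MODEL (O-NE9-1; #5 UNRULED); spine PROVED 0∕9; rung (B)+1 on a finite T⁴ — NOT infinite volume, NOT mass gap, NOT BetaPertH, NOT
Clay; HONEST DEPENDENCY: continuum YM on T⁴ ⇐ BetaPertH ∧ nine spine estimates (0/9 proved); BetaPertH ⇐ (D1) ∧ (D4) ∧ CAP+tail; G-an2-4 gates asym, D1 and NE2/3/4).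
NEW file importing `B11Eq117TransformationNormComp` and `B9Eq310HessianOperator`; nothing modified.  Net new unproved facts: 0.
-/

noncomputable section

set_option autoImplicit false

open scoped InnerProductSpace ComplexConjugate

namespace Literature.MathematicalPhysics.QuantumFieldTheory.Balaban1983to89.B11Eq117ReadLettersBridge

open B11Eq115Space B11Eq111FrakG
open B11Eq103H1Complex (BondL2K SiteL2K funEquiv readFun blockCLM115 H1CLM H1LatticeCLM frakGLatticeCLM H1LatticeK frakGLatticeK laplaceALatticeK
  funEquiv_apply funEquiv_symm_apply readFun_apply)
open B11Eq117TransformationNorm (frakGLin_fun_eq_readFun)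
open B11Eq117TransformationNormComp (norm_jetSymm_le_of_pair norm_toCLM115_le_of_comp)
open B9Eq311L2Pairing (WL2)
open B9SectCLatticeCarrier (Bond bpos btgt)
open B9Eq33CovDerivVector (covGrad covGrad_apply)
open B9Eq310HessianOperator (adTransportW adTransportW_apply)

/-! ## §1 The pair socket for BLOCK-FIELD letters `|·|_(−0) → (115)` -/

section Block

variable {ι β κ : Type*} [Fintype ι] [Fintype β] [Fintype κ] {V : Type*} [NormedAddCommGroup V] [NormedSpace ℂ V] [FiniteDimensional ℂ V]
  {L η : ℝ} [Fact (0 < L)] [Fact (0 < η)] {lev₀ : ι → ℕ} {levB : β → ℕ}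

/-- **THE NORM OF A BLOCK TRANSFORMATION `|·|_(−0) → (115)` FROM THE PAIR OF LETTERS `M_T`, `M_{∇T}`**, pointwise form: with `‖Tg‖ ≤ M_T‖g‖` and the
COMPOSITE bound `‖∇(Tg)‖ ≤ M_{∇T}‖g‖` (print's two rows (103) `|H₁B|`, `|∇H₁B|` for `H₁`, [5] Thm 3.12), `‖blockCLM115 ∇ T B‖ ≤ max(w̄₀·M_T, w̄₁·M_{∇T})·w̲_B⁻¹·‖B‖`.
[cite: Balaban1985Variational, (103) p.293, (117) p.295; Balaban1985BackgroundPropagators, Thm 3.12 p.423] -/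
theorem norm_blockCLM115_apply_le_of_comp (lev₁ : κ → ℕ) (Dc : (ι → V) →ₗ[ℂ] (κ → V)) (T : (β → V) →ₗ[ℂ] (ι → V)) {MT MDT : ℝ} (hMT : 0 ≤ MT)
    (hMDT : 0 ≤ MDT) (hT : ∀ g, ‖T g‖ ≤ MT * ‖g‖) (hDT : ∀ g, ‖Dc (T g)‖ ≤ MDT * ‖g‖) (B : NegSize L η levB 0 V) :
    ‖blockCLM115 (L := L) (η := η) (lev₀ := lev₀) lev₁ Dc T B‖ ≤
      max ((NegSup.wSup (levWeight L η lev₀ 1) : ℝ) * MT) (NegSup.wSup (levWeight L η lev₁ 2) * MDT) * NegSup.wInvSup (levWeight L η levB 0) * ‖B‖ := by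
  have h0 : blockCLM115 (L := L) (η := η) (lev₀ := lev₀) lev₁ Dc T B =
      (jetLinearEquiv L η lev₀ lev₁ Dc).symm (T (NegSup.equiv _ V B)) := rfl
  rw [h0]
  set X : ℝ := (NegSup.wInvSup (levWeight L η levB 0) : ℝ) * ‖B‖ with hX
  have hX0 : 0 ≤ X := mul_nonneg (NegSup.wInvSup (levWeight L η levB 0)).coe_nonneg (norm_nonneg _)
  have hg : ‖NegSup.equiv _ V B‖ ≤ X := NegSup.sup_norm_le_wInvSup_mul B
  have hT' : ‖T (NegSup.equiv _ V B)‖ ≤ MT * X := (hT _).trans (mul_le_mul_of_nonneg_left hg hMT)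
  have hDT' : ‖Dc (T (NegSup.equiv _ V B))‖ ≤ MDT * X := (hDT _).trans (mul_le_mul_of_nonneg_left hg hMDT)
  refine (norm_jetSymm_le_of_pair lev₁ Dc _ hT' hDT').trans ?_
  have e : max ((NegSup.wSup (levWeight L η lev₀ 1) : ℝ) * MT) (NegSup.wSup (levWeight L η lev₁ 2) * MDT) * NegSup.wInvSup (levWeight L η levB 0) * ‖B‖ =
      max ((NegSup.wSup (levWeight L η lev₀ 1) : ℝ) * MT) (NegSup.wSup (levWeight L η lev₁ 2) * MDT) * X := by rw [hX]; ring
  rw [e]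
  refine max_le ?_ ?_
  · calc (NegSup.wSup (levWeight L η lev₀ 1) : ℝ) * (MT * X) = (NegSup.wSup (levWeight L η lev₀ 1) : ℝ) * MT * X := by ring
      _ ≤ _ := mul_le_mul_of_nonneg_right (le_max_left _ _) hX0
  · calc (NegSup.wSup (levWeight L η lev₁ 2) : ℝ) * (MDT * X) = (NegSup.wSup (levWeight L η lev₁ 2) : ℝ) * MDT * X := by ring
      _ ≤ _ := mul_le_mul_of_nonneg_right (le_max_right _ _) hX0

/-- **THE NORM OF A BLOCK TRANSFORMATION `|·|_(−0) → (115)` FROM THE PAIR OF LETTERS**, operator-norm form: `‖blockCLM115 ∇ T‖ ≤ max(w̄₀·M_T, w̄₁·M_{∇T})·w̲_B⁻¹`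
— the height-free socket for (103)'s `H₁`-slot once `M_T`, `M_{∇T}` are height-free. [cite: Balaban1985Variational, (103) p.293; Balaban1985BackgroundPropagators, Thm 3.12 p.423] -/
theorem norm_blockCLM115_le_of_comp (lev₁ : κ → ℕ) (Dc : (ι → V) →ₗ[ℂ] (κ → V)) (T : (β → V) →ₗ[ℂ] (ι → V)) {MT MDT : ℝ} (hMT : 0 ≤ MT)
    (hMDT : 0 ≤ MDT) (hT : ∀ g, ‖T g‖ ≤ MT * ‖g‖) (hDT : ∀ g, ‖Dc (T g)‖ ≤ MDT * ‖g‖) :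
    ‖blockCLM115 (L := L) (η := η) (lev₀ := lev₀) (levB := levB) lev₁ Dc T‖ ≤
      max ((NegSup.wSup (levWeight L η lev₀ 1) : ℝ) * MT) (NegSup.wSup (levWeight L η lev₁ 2) * MDT) * NegSup.wInvSup (levWeight L η levB 0) := by
  refine ContinuousLinearMap.opNorm_le_bound _ ?_ (norm_blockCLM115_apply_le_of_comp lev₁ Dc T hMT hMDT hT hDT)
  exact mul_nonneg (le_max_of_le_left (mul_nonneg (NegSup.wSup (levWeight L η lev₀ 1)).coe_nonneg hMT)) (NegSup.wInvSup (levWeight L η levB 0)).coe_nonneg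

end Block

/-! ## §2 Reading identities and the pointwise prices `M_φ`, `M_φ′` -/

section Read

variable {ι ι' : Type*} [Fintype ι] [Fintype ι'] {V : Type*} [NormedAddCommGroup V] [NormedSpace ℂ V]
  {W : Type*} [NormedAddCommGroup W] [InnerProductSpace ℂ W] (φ : W ≃ₗ[ℂ] V) {w : ι → ℝ} {w' : ι' → ℝ}
  {Mφ Mφ' : ℝ} (hMφ : 0 ≤ Mφ) (hφ : ∀ v, ‖φ v‖ ≤ Mφ * ‖v‖) (hMφ' : 0 ≤ Mφ') (hφ' : ∀ X, ‖φ.symm X‖ ≤ Mφ' * ‖X‖)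

omit [Fintype ι'] in
include hMφ' hφ' in
/-- The input read in the Hilbert fibre: `‖(φ⁻¹∘g)(y)‖ ≤ M_φ′·‖g‖_∞` at every point. [cite: Balaban1985Averaging, (18)–(19) p.21] -/
theorem equiv_funEquiv_symm_norm_le (g : ι → V) (y : ι) : ‖WL2.equiv ℂ w W ((funEquiv φ w).symm g) y‖ ≤ Mφ' * ‖g‖ := by
  rw [funEquiv_symm_apply]
  exact (hφ' _).trans (mul_le_mul_of_nonneg_left (norm_le_pi_norm g y) hMφ')

include hMφ hφ hMφ' hφ' in
/-- **A `W`-LEVEL GLOBAL VALUE LETTER BECOMES THE `V`-LEVEL ONE AT THE PRICE `M_φM_φ′`**: if `‖(Tz)(x)‖ ≤ B·M` whenever `‖z(y)‖ ≤ M` (all `y`), then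
`‖readFun φ T g‖_∞ ≤ M_φ·B·M_φ′·‖g‖_∞`. [cite: Balaban1985Variational, (117) p.295; Balaban1985BackgroundPropagators, Thm 3.1 (3.47) p.398] -/
theorem norm_readFun_le_of_global (T : WL2 ℂ w W →ₗ[ℂ] WL2 ℂ w' W) {B : ℝ} (hB : 0 ≤ B)
    (hT : ∀ (z : WL2 ℂ w W) (M : ℝ), 0 ≤ M → (∀ y, ‖WL2.equiv ℂ w W z y‖ ≤ M) → ∀ x, ‖WL2.equiv ℂ w' W (T z) x‖ ≤ B * M) (g : ι → V) :
    ‖readFun φ w w' T g‖ ≤ Mφ * B * Mφ' * ‖g‖ := by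
  refine (pi_norm_le_iff_of_nonneg (by positivity)).2 fun x => ?_
  rw [readFun_apply, funEquiv_apply]
  refine (hφ _).trans ?_
  have h := hT ((funEquiv φ w).symm g) (Mφ' * ‖g‖) (by positivity) (equiv_funEquiv_symm_norm_le φ hMφ' hφ' g) x
  calc Mφ * ‖WL2.equiv ℂ w' W (T ((funEquiv φ w).symm g)) x‖ ≤ Mφ * (B * (Mφ' * ‖g‖)) := mul_le_mul_of_nonneg_left h hMφ
    _ = Mφ * B * Mφ' * ‖g‖ := by ring

end Read

section ReadGrad

variable {ι : Type*} [Fintype ι] {d : ℕ} {Pd : Fin d → ℕ} {𝔸 : Type*} [NormedRing 𝔸] [NormedAlgebra ℂ 𝔸]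
  {W : Type*} [NormedAddCommGroup W] [InnerProductSpace ℂ W] (φ : W ≃ₗ[ℂ] 𝔸) {w : ι → ℝ} {c₀ : ℝ}
  {Mφ Mφ' : ℝ} (hMφ : 0 ≤ Mφ) (hφ : ∀ v, ‖φ v‖ ≤ Mφ * ‖v‖) (hMφ' : 0 ≤ Mφ') (hφ' : ∀ X, ‖φ.symm X‖ ≤ Mφ' * ‖X‖)

omit [Fintype ι] in
/-- **`∇^{𝔸}_U(φ∘F) = φ∘∇^{W}_U F`**: the (115)-derivative `nabla115 η U` ([5] (3.3) with the transporters `Ad(U(b))` on `𝔸`) of a map READ along `φ` is `φ` of the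
covariant gradient with the transporters read in the Hilbert fibre (`adTransportW φ U = φ⁻¹∘Ad(U)∘φ`):
`nabla115 η U (readFun φ T g) p = φ (covGrad η⁻¹ (adTransportW φ U) (T(φ⁻¹∘g)) p)`. [cite: Balaban1985BackgroundPropagators, (3.3) p.391, p.390] -/
theorem nabla115_readFun_apply (η : ℝ) (U : Bond d Pd → 𝔸ˣ) (T : WL2 ℂ w W →ₗ[ℂ] BondL2K ℂ d Pd c₀ W) (g : ι → 𝔸) (p : Bond d Pd × Fin d) :
    nabla115 η U (readFun φ w (fun _ => c₀) T g) p =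
      φ (covGrad ((η : ℂ))⁻¹ (adTransportW φ U) (WL2.equiv ℂ (fun _ : Bond d Pd => c₀) W (T ((funEquiv φ w).symm g))) p) := by
  obtain ⟨b, ν⟩ := p
  rw [nabla115_apply, covGrad_apply, adTransportW_apply, map_smul, map_sub, LinearEquiv.apply_symm_apply, readFun_apply, funEquiv_apply, funEquiv_apply]

include hMφ hφ hMφ' hφ' in
/-- **A `W`-LEVEL GLOBAL GRADIENT LETTER BECOMES THE `𝔸`-LEVEL ONE AT THE PRICE `M_φM_φ′`**: if `‖(∇^{W}_U(Tz))(p)‖ ≤ B·M` whenever `‖z(y)‖ ≤ M`, then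
`‖nabla115 η U (readFun φ T g)‖_∞ ≤ M_φ·B·M_φ′·‖g‖_∞`. [cite: Balaban1985Variational, (117) p.295; Balaban1985BackgroundPropagators, Thm 3.1 (3.47) p.398, (3.3) p.391] -/
theorem norm_nabla115_readFun_le_of_global (η : ℝ) (U : Bond d Pd → 𝔸ˣ) (T : WL2 ℂ w W →ₗ[ℂ] BondL2K ℂ d Pd c₀ W) {B : ℝ} (hB : 0 ≤ B)
    (hDT : ∀ (z : WL2 ℂ w W) (M : ℝ), 0 ≤ M → (∀ y, ‖WL2.equiv ℂ w W z y‖ ≤ M) →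
      ∀ p, ‖covGrad ((η : ℂ))⁻¹ (adTransportW φ U) (WL2.equiv ℂ (fun _ : Bond d Pd => c₀) W (T z)) p‖ ≤ B * M) (g : ι → 𝔸) :
    ‖nabla115 η U (readFun φ w (fun _ => c₀) T g)‖ ≤ Mφ * B * Mφ' * ‖g‖ := by
  refine (pi_norm_le_iff_of_nonneg (by positivity)).2 fun p => ?_
  rw [nabla115_readFun_apply]
  refine (hφ _).trans ?_
  have h := hDT ((funEquiv φ w).symm g) (Mφ' * ‖g‖) (by positivity) (equiv_funEquiv_symm_norm_le φ hMφ' hφ' g) p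
  calc Mφ * ‖covGrad ((η : ℂ))⁻¹ (adTransportW φ U) (WL2.equiv ℂ (fun _ : Bond d Pd => c₀) W (T ((funEquiv φ w).symm g))) p‖
      ≤ Mφ * (B * (Mφ' * ‖g‖)) := mul_le_mul_of_nonneg_left h hMφ
    _ = Mφ * B * Mφ' * ‖g‖ := by ring

end ReadGrad

/-! ## §3 Operator norms in the space (115) over `𝔸` from `W`-level global letters -/

section OpNorm

variable {d : ℕ} {Pd : Fin d → ℕ} {β : Type*} [Fintype β] {𝔸 : Type*} [NormedRing 𝔸] [NormedAlgebra ℂ 𝔸] [FiniteDimensional ℂ 𝔸]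
  {W : Type*} [NormedAddCommGroup W] [InnerProductSpace ℂ W] (φ : W ≃ₗ[ℂ] 𝔸) {wB : β → ℝ} {c₀ : ℝ}
  {Lw ηw : ℝ} [Fact (0 < Lw)] [Fact (0 < ηw)] {lev₀ : Bond d Pd → ℕ} {levB : β → ℕ}
  {Mφ Mφ' : ℝ} (hMφ : 0 ≤ Mφ) (hφ : ∀ v, ‖φ v‖ ≤ Mφ * ‖v‖) (hMφ' : 0 ≤ Mφ') (hφ' : ∀ X, ‖φ.symm X‖ ≤ Mφ' * ‖X‖)

include hMφ hφ hMφ' hφ' in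
/-- **THE (117) SOCKET IN THE CHART's CURRENCY for a bond → bond operator read along `φ`**: `W`-level global value and gradient letters (constants `B₀`, `B₁`) give
`‖toCLM115 (∇_U) (readFun φ T)‖ ≤ max(w̄₀·M_φB₀M_φ′, w̄₁·M_φB₁M_φ′)·w̲₃⁻¹`.
[cite: Balaban1985Variational, (117) p.295; Balaban1985BackgroundPropagators, Thm 3.13 p.426, Thm 3.1 (3.47) p.398] -/
theorem norm_toCLM115_readFun_le_of_global (η : ℝ) (U : Bond d Pd → 𝔸ˣ) (lev₁ : Bond d Pd × Fin d → ℕ)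
    (T : BondL2K ℂ d Pd c₀ W →ₗ[ℂ] BondL2K ℂ d Pd c₀ W) {B₀ B₁ : ℝ} (hB₀ : 0 ≤ B₀) (hB₁ : 0 ≤ B₁)
    (hT : ∀ (z : BondL2K ℂ d Pd c₀ W) (M : ℝ), 0 ≤ M → (∀ y, ‖WL2.equiv ℂ (fun _ : Bond d Pd => c₀) W z y‖ ≤ M) →
      ∀ x, ‖WL2.equiv ℂ (fun _ : Bond d Pd => c₀) W (T z) x‖ ≤ B₀ * M)
    (hDT : ∀ (z : BondL2K ℂ d Pd c₀ W) (M : ℝ), 0 ≤ M → (∀ y, ‖WL2.equiv ℂ (fun _ : Bond d Pd => c₀) W z y‖ ≤ M) →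
      ∀ p, ‖covGrad ((η : ℂ))⁻¹ (adTransportW φ U) (WL2.equiv ℂ (fun _ : Bond d Pd => c₀) W (T z)) p‖ ≤ B₁ * M) :
    ‖toCLM115 (L := Lw) (η := ηw) (lev₀ := lev₀) lev₁ (nabla115 η U) (readFun φ (fun _ => c₀) (fun _ => c₀) T)‖ ≤
      max ((NegSup.wSup (levWeight Lw ηw lev₀ 1) : ℝ) * (Mφ * B₀ * Mφ')) (NegSup.wSup (levWeight Lw ηw lev₁ 2) * (Mφ * B₁ * Mφ')) *
        NegSup.wInvSup (levWeight Lw ηw lev₀ 3) :=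
  norm_toCLM115_le_of_comp lev₁ (nabla115 η U) _ (by positivity) (by positivity) (norm_readFun_le_of_global φ hMφ hφ hMφ' hφ' T hB₀ hT)
    (norm_nabla115_readFun_le_of_global φ hMφ hφ hMφ' hφ' η U T hB₁ hDT)

include hMφ hφ hMφ' hφ' in
/-- **THE (103) SOCKET IN THE CHART's CURRENCY for a block → bond operator read along `φ` (`H1CLM φ ∇ H₁`)**: `W`-level global value and gradient letters give
`‖H1CLM φ (∇_U) H₁‖ ≤ max(w̄₀·M_φB₀M_φ′, w̄₁·M_φB₁M_φ′)·w̲_B⁻¹`. [cite: Balaban1985Variational, (103) p.293, (174) p.305; Balaban1985BackgroundPropagators, Thm 3.12 p.423] -/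
theorem norm_H1CLM_le_of_global [Fact (∀ y, 0 < wB y)] (η : ℝ) (U : Bond d Pd → 𝔸ˣ) (lev₁ : Bond d Pd × Fin d → ℕ)
    (H₁ : WL2 ℂ wB W →ₗ[ℂ] BondL2K ℂ d Pd c₀ W) {B₀ B₁ : ℝ} (hB₀ : 0 ≤ B₀) (hB₁ : 0 ≤ B₁)
    (hT : ∀ (z : WL2 ℂ wB W) (M : ℝ), 0 ≤ M → (∀ y, ‖WL2.equiv ℂ wB W z y‖ ≤ M) → ∀ x, ‖WL2.equiv ℂ (fun _ : Bond d Pd => c₀) W (H₁ z) x‖ ≤ B₀ * M)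
    (hDT : ∀ (z : WL2 ℂ wB W) (M : ℝ), 0 ≤ M → (∀ y, ‖WL2.equiv ℂ wB W z y‖ ≤ M) →
      ∀ p, ‖covGrad ((η : ℂ))⁻¹ (adTransportW φ U) (WL2.equiv ℂ (fun _ : Bond d Pd => c₀) W (H₁ z)) p‖ ≤ B₁ * M) :
    ‖H1CLM (L := Lw) (η := ηw) (lev₀ := lev₀) (levB := levB) φ lev₁ (nabla115 η U) H₁‖ ≤
      max ((NegSup.wSup (levWeight Lw ηw lev₀ 1) : ℝ) * (Mφ * B₀ * Mφ')) (NegSup.wSup (levWeight Lw ηw lev₁ 2) * (Mφ * B₁ * Mφ')) *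
        NegSup.wInvSup (levWeight Lw ηw levB 0) :=
  norm_blockCLM115_le_of_comp lev₁ (nabla115 η U) _ (by positivity) (by positivity) (norm_readFun_le_of_global φ hMφ hφ hMφ' hφ' H₁ hB₀ hT)
    (norm_nabla115_readFun_le_of_global φ hMφ hφ hMφ' hφ' η U H₁ hB₁ hDT)

end OpNorm

/-! ## §4 At the lattice letters: the chart's `𝔊 = frakGLatticeCLM φ hpos hQ` and `H₁ = H1LatticeCLM φ hpos hQ` -/

section Lattice

variable {d : ℕ} {Pd : Fin d → ℕ} {β : Type*} [Fintype β] {𝔸 : Type*} [NormedRing 𝔸] [NormedAlgebra ℂ 𝔸] [FiniteDimensional ℂ 𝔸]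
  {W : Type*} [NormedAddCommGroup W] [InnerProductSpace ℂ W] [FiniteDimensional ℂ W] (φ : W ≃ₗ[ℂ] 𝔸)
  {Lw ηw : ℝ} [Fact (0 < Lw)] [Fact (0 < ηw)] {lev₀ : Bond d Pd → ℕ} {levB : β → ℕ} {c₀ : ℝ} [Fact (0 < c₀)] {wB : β → ℝ} [Fact (∀ y, 0 < wB y)]
  {c : ℂ} {R S : Bond d Pd → W →ₗ[ℂ] W} {Δ₁ : BondL2K ℂ d Pd c₀ W →ₗ[ℂ] BondL2K ℂ d Pd c₀ W}
  {Rr : SiteL2K ℂ d Pd c₀ W →ₗ[ℂ] SiteL2K ℂ d Pd c₀ W} {Q : BondL2K ℂ d Pd c₀ W →ₗ[ℂ] WL2 ℂ wB W} {a : ℝ}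
  (hpos : ∀ x : BondL2K ℂ d Pd c₀ W, x ≠ 0 → 0 < RCLike.re ⟪x, laplaceALatticeK c R S Δ₁ Rr Q a x⟫_ℂ) (hQ : Function.Surjective Q)
  {Mφ Mφ' : ℝ} (hMφ : 0 ≤ Mφ) (hφ : ∀ v, ‖φ v‖ ≤ Mφ * ‖v‖) (hMφ' : 0 ≤ Mφ') (hφ' : ∀ X, ‖φ.symm X‖ ≤ Mφ' * ‖X‖)

/-- **The chart's `𝔊` IS the Hilbert-level `𝔊 = frakGLatticeK hpos hQ` read on the functions, in the type of (117)**: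
`frakGLatticeCLM φ hpos hQ lev₁ ∇ = toCLM115 ∇ (readFun φ (frakGLatticeK hpos hQ))` (the three words commute with the identification, `frakGLin_fun_eq_readFun`).
[cite: Balaban1985Variational, (110)–(111) p.294, (117) p.295] -/
theorem frakGLatticeCLM_eq_toCLM115_readFun {κ : Type*} [Fintype κ] (lev₁ : κ → ℕ) (Dc : (Bond d Pd → 𝔸) →ₗ[ℂ] (κ → 𝔸)) :
    frakGLatticeCLM (L := Lw) (η := ηw) (lev₀ := lev₀) φ hpos hQ lev₁ Dc =
      toCLM115 (L := Lw) (η := ηw) (lev₀ := lev₀) lev₁ Dc (readFun φ (fun _ => c₀) (fun _ => c₀) (frakGLatticeK hpos hQ)) := by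
  unfold frakGLatticeCLM frakG frakGLatticeK
  rw [frakGLin_fun_eq_readFun]

include hMφ hφ hMφ' hφ' in
/-- **THE (117) SOCKET IN THE CHART's CURRENCY**: `W`-level global sup → sup letters of `𝔊 = frakGLatticeK hpos hQ` — value (`B₀`) and covariant gradient
`∇_U = covGrad η⁻¹ Ad_W(U)` (`B₁`) — give `‖frakGLatticeCLM φ hpos hQ lev₁ (nabla115 η U)‖ ≤ max(w̄₀·M_φB₀M_φ′, w̄₁·M_φB₁M_φ′)·w̲₃⁻¹` for ANY level ∕ weight profile of (115).
[cite: Balaban1985Variational, (117) p.295; Balaban1985BackgroundPropagators, Thm 3.13 p.426, Thm 3.1 (3.47) p.398] -/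
theorem norm_frakGLatticeCLM_le_of_global (η : ℝ) (U : Bond d Pd → 𝔸ˣ) (lev₁ : Bond d Pd × Fin d → ℕ) {B₀ B₁ : ℝ} (hB₀ : 0 ≤ B₀) (hB₁ : 0 ≤ B₁)
    (hT : ∀ (z : BondL2K ℂ d Pd c₀ W) (M : ℝ), 0 ≤ M → (∀ y, ‖WL2.equiv ℂ (fun _ : Bond d Pd => c₀) W z y‖ ≤ M) →
      ∀ x, ‖WL2.equiv ℂ (fun _ : Bond d Pd => c₀) W (frakGLatticeK hpos hQ z) x‖ ≤ B₀ * M)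
    (hDT : ∀ (z : BondL2K ℂ d Pd c₀ W) (M : ℝ), 0 ≤ M → (∀ y, ‖WL2.equiv ℂ (fun _ : Bond d Pd => c₀) W z y‖ ≤ M) →
      ∀ p, ‖covGrad ((η : ℂ))⁻¹ (adTransportW φ U) (WL2.equiv ℂ (fun _ : Bond d Pd => c₀) W (frakGLatticeK hpos hQ z)) p‖ ≤ B₁ * M) :
    ‖frakGLatticeCLM (L := Lw) (η := ηw) (lev₀ := lev₀) φ hpos hQ lev₁ (nabla115 η U)‖ ≤
      max ((NegSup.wSup (levWeight Lw ηw lev₀ 1) : ℝ) * (Mφ * B₀ * Mφ')) (NegSup.wSup (levWeight Lw ηw lev₁ 2) * (Mφ * B₁ * Mφ')) *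
        NegSup.wInvSup (levWeight Lw ηw lev₀ 3) := by
  rw [frakGLatticeCLM_eq_toCLM115_readFun]
  exact norm_toCLM115_readFun_le_of_global φ hMφ hφ hMφ' hφ' η U lev₁ _ hB₀ hB₁ hT hDT

include hMφ hφ hMφ' hφ' in
/-- **THE (103) SOCKET IN THE CHART's CURRENCY**: `W`-level global sup → sup letters of `H₁ = H1LatticeK hpos hQ` (value `B₀`, covariant gradient `B₁`) give
`‖H1LatticeCLM φ hpos hQ lev₁ (nabla115 η U)‖ ≤ max(w̄₀·M_φB₀M_φ′, w̄₁·M_φB₁M_φ′)·w̲_B⁻¹`.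
[cite: Balaban1985Variational, (103) p.293, (174) p.305; Balaban1985BackgroundPropagators, Thm 3.12 p.423, Thm 3.1 (3.47) p.398] -/
theorem norm_H1LatticeCLM_le_of_global (η : ℝ) (U : Bond d Pd → 𝔸ˣ) (lev₁ : Bond d Pd × Fin d → ℕ) {B₀ B₁ : ℝ} (hB₀ : 0 ≤ B₀) (hB₁ : 0 ≤ B₁)
    (hT : ∀ (z : WL2 ℂ wB W) (M : ℝ), 0 ≤ M → (∀ y, ‖WL2.equiv ℂ wB W z y‖ ≤ M) →
      ∀ x, ‖WL2.equiv ℂ (fun _ : Bond d Pd => c₀) W (H1LatticeK hpos hQ z) x‖ ≤ B₀ * M)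
    (hDT : ∀ (z : WL2 ℂ wB W) (M : ℝ), 0 ≤ M → (∀ y, ‖WL2.equiv ℂ wB W z y‖ ≤ M) →
      ∀ p, ‖covGrad ((η : ℂ))⁻¹ (adTransportW φ U) (WL2.equiv ℂ (fun _ : Bond d Pd => c₀) W (H1LatticeK hpos hQ z)) p‖ ≤ B₁ * M) :
    ‖H1LatticeCLM (L := Lw) (η := ηw) (lev₀ := lev₀) (levB := levB) φ hpos hQ lev₁ (nabla115 η U)‖ ≤
      max ((NegSup.wSup (levWeight Lw ηw lev₀ 1) : ℝ) * (Mφ * B₀ * Mφ')) (NegSup.wSup (levWeight Lw ηw lev₁ 2) * (Mφ * B₁ * Mφ')) *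
        NegSup.wInvSup (levWeight Lw ηw levB 0) :=
  norm_H1CLM_le_of_global φ hMφ hφ hMφ' hφ' η U lev₁ _ hB₀ hB₁ hT hDT

end Lattice

end Literature.MathematicalPhysics.QuantumFieldTheory.Balaban1983to89.B11Eq117ReadLettersBridge

end
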